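import Summits.CriticalPhenomena.PercolationContinuityZ3.Theorems.PercNearOneGluingNoHeavyQuantIndepLegsFar
import HarnessLib

/-!
# QUANT lane R8: FAR for independent legs with an arbitrary RELAY SUBSET (spiders with non-relay path vertices)

builds on p205010 (kernel theorem, internal audit signed; external expert review pending)

Support file (`--supports stmt-CriticalPhenomena-4575`), QUANT lane seat prim-quant-census-1 (gen 6); third part of
`…QuantIndepLegsFar.lean` (p217240) / `…QuantIndepLegsFarRank.lean` (p218245).  Memo: `run/shared/lean/prim/quant/CENSUS-GAIN.md` §14.
Theorems only; no definitions, no sorries, standard axioms.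

p217240's `Quant.far_indepLegs` counts EVERY gate as a relay.  For the percolation-vocabulary bridge (a spider graph on `Fin n`, where only
the vertices of `A` are relays and the other path vertices are plain gates) one needs the same statement for an arbitrary relay set
`B ⊆ ι`: `N_B(ω) = #{x ∈ B | prefix of x open}`, `E N_B = Σ_{x ∈ B} T x`.

* `Quant.indepLegs_rank_smallBall_sub` — the rank form for relay subsets `B ⊆ C` (no mean hypothesis, `t ≤ 1/2`).
* `Quant.indepLegs_cantelli_sub` — Cantelli bound for `N_B` when every leg carries at most `j` relays of `B`.
* `Quant.far_indepLegs_sub` (+ `far_indepLegs_sub_root`, the `o ∈ A` cell) — **FAR for spiders with relay set `B`:** `2j < Σ_{x∈B} T x` and `1 − T x ≤ t` on `B` imply `P(N_B ≤ j) ≤ t`.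
  Regimes: a leg with `≥ j+1` relays of `B` (its deepest `B`-prefix is shut on the light event) / `t ≤ 1/2`: `indepLegs_rank_smallBall_sub`
  with `C = B` (`#B ≥ 2j+1`) / `t ≥ 1/2`: `indepLegs_cantelli_sub`.
[cite: KozmaNitzan2024, Lemma 2 (p. 6), Conjecture 3 (p. 15)]
-/

noncomputable section

namespace Summit.CriticalPhenomena.PercolationContinuityZ3.Theorems

open MeasureTheory Set Finset
open Literature.Probability.LatticeModels
open Literature.Probability.Percolation (prodBernoulli_real_eq_sum_weight_ind)
open Literature.Probability.Percolation.BHK2006 (weight weight_nonneg)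
open Literature.Probability.Percolation.DecisionTree (ind ind_of_mem ind_of_not_mem ind_nonneg)
open scoped Classical

namespace Quant

variable {ι J : Type*} [Fintype ι] [Fintype J]

/-- **Rank form, relay subsets.**  If `B ⊆ C`, `#B ≥ 2j+1` and every relay of `B` has marginal `≥ 1 − t ≥ 1/2`, then
`P(#{x ∈ C | prefix of x open} ≤ j) ≤ t` (top-blob domination restricted to `B`, block principle, `halfMean_smallBall_of_card`). [this work] -/
theorem indepLegs_rank_smallBall_sub (leg : ι → J) (depth : ι → ℕ) (p : ι → unitInterval) (B C : Finset ι) (hBC : B ⊆ C)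
    (j : ℕ) (t : ℝ) (ht2 : t ≤ 1 / 2) (hB : 2 * j + 1 ≤ B.card)
    (ht : ∀ x ∈ B, 1 - ∏ y ∈ univ.filter (fun y => leg y = leg x ∧ depth y ≤ depth x), (p y : ℝ) ≤ t) :
    (prodBernoulli p).real {ω : Set ι |
      (C.filter (fun x => ((univ.filter (fun y => leg y = leg x ∧ depth y ≤ depth x) : Finset ι) : Set ι) ⊆ ω)).card ≤ j} ≤ t := by
  set μ := prodBernoulli p with hμ
  set P : ι → Finset ι := fun x => univ.filter (fun y => leg y = leg x ∧ depth y ≤ depth x) with hP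
  set E : Set (Set ι) := {ω : Set ι | (C.filter (fun x => ((P x : Finset ι) : Set ι) ⊆ ω)).card ≤ j} with hE
  have hp0 : ∀ i, (0 : ℝ) ≤ p i := fun i => (p i).2.1
  have hp1 : ∀ i, (p i : ℝ) ≤ 1 := fun i => (p i).2.2
  have hBne : B.Nonempty := Finset.card_pos.1 (by omega)
  obtain ⟨x₀, hx₀⟩ := hBne
  have hT1x : ∏ y ∈ P x₀, (p y : ℝ) ≤ 1 := Finset.prod_le_one (fun y _ => hp0 y) fun y _ => hp1 y
  have ht0 : 0 ≤ t := by linarith [ht x₀ hx₀]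
  set F : J → Finset ι := fun j' => univ.filter (fun y => leg y = j' ∧ ∃ x ∈ B, leg x = j' ∧ depth y ≤ depth x) with hF
  set a : J → ℕ := fun j' => (B.filter (fun x => leg x = j')).card with ha
  have hPF : ∀ x ∈ B, P x ⊆ F (leg x) := by
    intro x hx y hy
    simp only [hP, Finset.mem_filter, Finset.mem_univ, true_and] at hy
    simp only [hF, Finset.mem_filter, Finset.mem_univ, true_and]
    exact ⟨hy.1, x, hx, rfl, hy.2⟩
  have hdeep : ∀ j', (B.filter (fun x => leg x = j')).Nonempty → ∃ x ∈ B, leg x = j' ∧ P x = F j' := by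
    intro j' hne
    obtain ⟨x, hx, hmax⟩ := Finset.exists_max_image (B.filter (fun x => leg x = j')) depth hne
    rw [Finset.mem_filter] at hx
    refine ⟨x, hx.1, hx.2, Finset.Subset.antisymm (by rw [← hx.2]; exact hPF x hx.1) fun y hy => ?_⟩
    simp only [hF, Finset.mem_filter, Finset.mem_univ, true_and] at hy
    obtain ⟨hly, x', hx'B, hlx', hyx'⟩ := hy
    have hx'depth : depth x' ≤ depth x := hmax x' (Finset.mem_filter.2 ⟨hx'B, hlx'⟩)
    simp only [hP, Finset.mem_filter, Finset.mem_univ, true_and]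
    exact ⟨hly.trans hx.2.symm, hyx'.trans hx'depth⟩
  have hFempty : ∀ j', ¬ (B.filter (fun x => leg x = j')).Nonempty → F j' = ∅ := by
    intro j' hne
    rw [Finset.not_nonempty_iff_eq_empty, Finset.filter_eq_empty_iff] at hne
    simp only [hF, Finset.filter_eq_empty_iff, Finset.mem_univ, true_implies, not_and, not_exists]
    intro y _ x hx hlx
    exact absurd hlx (hne hx)
  set g : J → Set ι → Prop := fun j' ω => ((F j' : Finset ι) : Set ι) ⊆ ω with hg
  have hloc : IsBlockLocal leg g := by
    intro j' ω ω' hagree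
    simp only [hg, Set.subset_def, Finset.mem_coe]
    refine forall_congr' fun e => ?_
    refine imp_congr_right fun he => ?_
    have : leg e = j' := by
      simp only [hF, Finset.mem_filter, Finset.mem_univ, true_and] at he; exact he.1
    exact hagree e this
  have hmeas : ∀ j', Measurable (g j') := fun j' => Measurable.of_discrete
  set q : J → unitInterval := fun j' => ⟨∏ y ∈ F j', (p y : ℝ),
    Finset.prod_nonneg fun y _ => hp0 y, Finset.prod_le_one (fun y _ => hp0 y) fun y _ => hp1 y⟩ with hq
  have hq' : ∀ j', μ.real {ω | g j' ω} = q j' := fun j' => prodBernoulli_real_subset p (F j')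
  have hqt : ∀ j', 1 - (q j' : ℝ) ≤ t := by
    intro j'
    by_cases hne : (B.filter (fun x => leg x = j')).Nonempty
    · obtain ⟨x, hxB, -, hx⟩ := hdeep j' hne
      have : (q j' : ℝ) = ∏ y ∈ P x, (p y : ℝ) := by simp only [hq]; rw [hx]
      rw [this]; exact ht x hxB
    · have h0 := hFempty j' hne
      have : (q j' : ℝ) = 1 := by simp [hq, h0]
      rw [this]; linarith
  have hT : 2 * j + 1 ≤ ∑ j', a j' := by
    have : B.card = ∑ j', a j' := Finset.card_eq_sum_card_fiberwise fun x _ => Finset.mem_univ (leg x)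
    omega
  set L : Set (Set J) := {S : Set J | ∑ j' ∈ univ.filter (fun j' => j' ∈ S), a j' ≤ j} with hL
  have hsub : E ⊆ (fun ω => {j' | g j' ω}) ⁻¹' L := by
    intro ω hω
    simp only [Set.mem_preimage, hL, Set.mem_setOf_eq]
    have hωE : (C.filter (fun x => ((P x : Finset ι) : Set ι) ⊆ ω)).card ≤ j := hω
    set S' : Finset J := univ.filter (fun j' => j' ∈ {j'' | g j'' ω}) with hS'
    have hdisj : ∀ u ∈ S', ∀ v ∈ S', u ≠ v →
        Disjoint (B.filter (fun x => leg x = u)) (B.filter (fun x => leg x = v)) := by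
      intro u _ v _ huv
      rw [Finset.disjoint_left]
      intro x hxu hxv
      rw [Finset.mem_filter] at hxu hxv
      exact huv (hxu.2.symm.trans hxv.2)
    have hbi : (S'.biUnion fun j' => B.filter (fun x => leg x = j')).card = ∑ j' ∈ S', a j' :=
      Finset.card_biUnion hdisj
    have hincl : (S'.biUnion fun j' => B.filter (fun x => leg x = j')) ⊆
        C.filter (fun x => ((P x : Finset ι) : Set ι) ⊆ ω) := by
      intro x hx
      rw [Finset.mem_biUnion] at hx
      obtain ⟨j', hj', hxj⟩ := hx
      rw [Finset.mem_filter] at hxj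
      have hgj : ((F j' : Finset ι) : Set ι) ⊆ ω := by
        have : j' ∈ {j'' | g j'' ω} := by simpa [hS'] using hj'
        exact this
      refine Finset.mem_filter.2 ⟨hBC hxj.1, fun y hy => ?_⟩
      have hy' : y ∈ F j' := by rw [← hxj.2]; exact hPF x hxj.1 (Finset.mem_coe.1 hy)
      exact hgj (Finset.mem_coe.2 hy')
    calc ∑ j' ∈ S', a j' = (S'.biUnion fun j' => B.filter (fun x => leg x = j')).card := hbi.symm
      _ ≤ (C.filter (fun x => ((P x : Finset ι) : Set ι) ⊆ ω)).card := Finset.card_le_card hincl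
      _ ≤ j := hωE
  have hpre : μ.real ((fun ω => {j' | g j' ω}) ⁻¹' L) = (prodBernoulli q).real L :=
    prodBernoulli_real_preimage_readBlocks p leg hloc hmeas q hq' MeasurableSet.of_discrete
  calc μ.real E ≤ μ.real ((fun ω => {j' | g j' ω}) ⁻¹' L) := measureReal_mono hsub (measure_ne_top _ _)
    _ = (prodBernoulli q).real L := hpre
    _ ≤ t := halfMean_smallBall_of_card q a j t ht2 hqt hT

omit [Fintype J] in
/-- **Cantelli bound for independent legs, relay subset `B`.**  With `T x = ∏_{prefix x} p`, `m = Σ_{x∈B} T x > j`, every leg carrying at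
most `j` relays of `B` and `1 − T x ≤ t` on `B`: `4 (m − j)² · P(N_B ≤ j) ≤ j·t·m + (m − j)²`. [folklore; Cantelli 1928 / one-sided Chebyshev] -/
theorem indepLegs_cantelli_sub (leg : ι → J) (depth : ι → ℕ) (p : ι → unitInterval) (B : Finset ι) (j : ℕ) (t : ℝ)
    (hfib : ∀ x ∈ B, (B.filter (fun y => leg y = leg x)).card ≤ j)
    (ht : ∀ x ∈ B, 1 - ∏ y ∈ univ.filter (fun y => leg y = leg x ∧ depth y ≤ depth x), (p y : ℝ) ≤ t)
    (hjm : (j : ℝ) < ∑ x ∈ B, ∏ y ∈ univ.filter (fun y => leg y = leg x ∧ depth y ≤ depth x), (p y : ℝ)) :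
    4 * ((∑ x ∈ B, ∏ y ∈ univ.filter (fun y => leg y = leg x ∧ depth y ≤ depth x), (p y : ℝ)) - j) ^ 2 *
        (prodBernoulli p).real {ω : Set ι |
          (B.filter (fun x => ((univ.filter (fun y => leg y = leg x ∧ depth y ≤ depth x) : Finset ι) : Set ι) ⊆ ω)).card ≤ j} ≤
      (j : ℝ) * t * (∑ x ∈ B, ∏ y ∈ univ.filter (fun y => leg y = leg x ∧ depth y ≤ depth x), (p y : ℝ)) +
        ((∑ x ∈ B, ∏ y ∈ univ.filter (fun y => leg y = leg x ∧ depth y ≤ depth x), (p y : ℝ)) - j) ^ 2 := by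
  set μ := prodBernoulli p with hμ
  set P : ι → Finset ι := fun x => univ.filter (fun y => leg y = leg x ∧ depth y ≤ depth x) with hP
  set T : ι → ℝ := fun x => ∏ y ∈ P x, (p y : ℝ) with hT
  set E : Set (Set ι) := {ω : Set ι | (B.filter (fun x => ((P x : Finset ι) : Set ι) ⊆ ω)).card ≤ j} with hE
  set m : ℝ := ∑ x ∈ B, T x with hm
  set lam : ℝ := m - j with hlam
  set W : Set ι → ℝ := weight (fun e => (p e : ℝ)) with hW
  set X : Set ι → ℝ := fun s => ∑ x ∈ B, ind {ω : Set ι | ((P x : Finset ι) : Set ι) ⊆ ω} s with hX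
  have hp0 : ∀ i, (0 : ℝ) ≤ p i := fun i => (p i).2.1
  have hp1 : ∀ i, (p i : ℝ) ≤ 1 := fun i => (p i).2.2
  have hT0 : ∀ x, 0 ≤ T x := fun x => Finset.prod_nonneg fun y _ => hp0 y
  have hT1 : ∀ x, T x ≤ 1 := fun x => Finset.prod_le_one (fun y _ => hp0 y) fun y _ => hp1 y
  have hW0 : ∀ s, 0 ≤ W s := fun s => weight_nonneg hp0 hp1 s
  have hW1 : ∑ s, W s = 1 := by
    have h := prodBernoulli_real_eq_sum_weight_ind p (Set.univ : Set (Set ι))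
    rw [probReal_univ] at h
    rw [h]
    refine Finset.sum_congr rfl fun s _ => ?_
    rw [ind_of_mem (Set.mem_univ s), mul_one]
  have hW2 : ∀ Q : Finset ι, ∑ s, W s * ind {ω : Set ι | ((Q : Finset ι) : Set ι) ⊆ ω} s = ∏ y ∈ Q, (p y : ℝ) := by
    intro Q
    rw [← prodBernoulli_real_eq_sum_weight_ind p {ω : Set ι | ((Q : Finset ι) : Set ι) ⊆ ω}, prodBernoulli_real_subset]
  have hW3 : ∀ (Q Q' : Finset ι) (s : Set ι),
      ind {ω : Set ι | ((Q : Finset ι) : Set ι) ⊆ ω} s * ind {ω : Set ι | ((Q' : Finset ι) : Set ι) ⊆ ω} s =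
        ind {ω : Set ι | (((Q ∪ Q' : Finset ι)) : Set ι) ⊆ ω} s := by
    intro Q Q' s
    rw [← Literature.Probability.Percolation.BHK2006.ind_inter]
    congr 1
    ext ω
    simp only [Set.mem_inter_iff, Set.mem_setOf_eq, Finset.coe_union, Set.union_subset_iff]
  have hmean : ∑ s, W s * X s = m := by
    simp_rw [hX, Finset.mul_sum]
    rw [Finset.sum_comm]
    exact Finset.sum_congr rfl fun x _ => hW2 (P x)
  have hQ : ∑ s, W s * X s ^ 2 = ∑ x ∈ B, ∑ x' ∈ B, ∏ y ∈ P x ∪ P x', (p y : ℝ) := by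
    have hsq : ∀ s, X s ^ 2 = ∑ x ∈ B, ∑ x' ∈ B, ind {ω : Set ι | (((P x ∪ P x' : Finset ι)) : Set ι) ⊆ ω} s := by
      intro s
      rw [hX, sq, Finset.sum_mul_sum]
      refine Finset.sum_congr rfl fun x _ => Finset.sum_congr rfl fun x' _ => hW3 (P x) (P x') s
    simp_rw [hsq, Finset.mul_sum]
    rw [Finset.sum_comm]
    refine Finset.sum_congr rfl fun x _ => ?_
    rw [Finset.sum_comm]
    exact Finset.sum_congr rfl fun x' _ => hW2 (P x ∪ P x')
  have hm2 : m ^ 2 = ∑ x ∈ B, ∑ x' ∈ B, T x * T x' := by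
    rw [hm, sq, Finset.sum_mul_sum]
  have hvar : ∑ s, W s * (X s - m) ^ 2 = ∑ x ∈ B, ∑ x' ∈ B, (∏ y ∈ P x ∪ P x', (p y : ℝ) - T x * T x') := by
    have hexp : ∀ s, W s * (X s - m) ^ 2 = W s * X s ^ 2 - 2 * m * (W s * X s) + m ^ 2 * W s := by
      intro s; ring
    simp_rw [hexp]
    rw [Finset.sum_add_distrib, Finset.sum_sub_distrib, ← Finset.mul_sum, ← Finset.mul_sum, hmean, hW1, hQ]
    have : ∑ x ∈ B, ∑ x' ∈ B, ∏ y ∈ P x ∪ P x', (p y : ℝ) - 2 * m * m + m ^ 2 * 1 =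
        ∑ x ∈ B, ∑ x' ∈ B, ∏ y ∈ P x ∪ P x', (p y : ℝ) - m ^ 2 := by ring
    rw [this, hm2, ← Finset.sum_sub_distrib]
    refine Finset.sum_congr rfl fun x _ => ?_
    rw [← Finset.sum_sub_distrib]
  have hpair : ∀ x ∈ B, ∀ x' ∈ B, ∏ y ∈ P x ∪ P x', (p y : ℝ) - T x * T x' ≤ if leg x = leg x' then t * T x' else 0 := by
    intro x hx x' hx'
    by_cases hl : leg x = leg x'
    · rw [if_pos hl]
      have hsub : P x' ⊆ P x ∪ P x' := Finset.subset_union_right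
      have hle : ∏ y ∈ P x ∪ P x', (p y : ℝ) ≤ T x' := by
        rw [hT]
        show ∏ y ∈ P x ∪ P x', (p y : ℝ) ≤ ∏ y ∈ P x', (p y : ℝ)
        rw [← Finset.prod_sdiff hsub]
        have h1 : ∏ y ∈ (P x ∪ P x') \ P x', (p y : ℝ) ≤ 1 :=
          Finset.prod_le_one (fun y _ => hp0 y) fun y _ => hp1 y
        have h2 : 0 ≤ ∏ y ∈ P x', (p y : ℝ) := Finset.prod_nonneg fun y _ => hp0 y
        nlinarith
      have h3 : 1 - T x ≤ t := ht x hx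
      have h4 : 0 ≤ T x' := hT0 x'
      nlinarith
    · rw [if_neg hl]
      have hdisj : Disjoint (P x) (P x') := by
        rw [Finset.disjoint_left]
        intro y hy hy'
        simp only [hP, Finset.mem_filter, Finset.mem_univ, true_and] at hy hy'
        exact hl (hy.1.symm.trans hy'.1)
      rw [Finset.prod_union hdisj]
      simp [hT]
  have ht0B : ∀ x' ∈ B, 0 ≤ t := fun x' hx' => le_trans (by linarith [hT1 x']) (ht x' hx')
  have hvarle : ∑ s, W s * (X s - m) ^ 2 ≤ (j : ℝ) * t * m := by
    rw [hvar]
    calc ∑ x ∈ B, ∑ x' ∈ B, (∏ y ∈ P x ∪ P x', (p y : ℝ) - T x * T x')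
        ≤ ∑ x ∈ B, ∑ x' ∈ B, (if leg x = leg x' then t * T x' else 0) :=
          Finset.sum_le_sum fun x hx => Finset.sum_le_sum fun x' hx' => hpair x hx x' hx'
      _ = ∑ x' ∈ B, ∑ x ∈ B, (if leg x = leg x' then t * T x' else 0) := Finset.sum_comm
      _ = ∑ x' ∈ B, ((B.filter (fun x => leg x = leg x')).card : ℝ) * (t * T x') := by
          refine Finset.sum_congr rfl fun x' _ => ?_
          rw [← Finset.sum_filter, Finset.sum_const, nsmul_eq_mul]
      _ ≤ ∑ x' ∈ B, (j : ℝ) * (t * T x') := by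
          refine Finset.sum_le_sum fun x' hx' => ?_
          have h1 : ((B.filter (fun x => leg x = leg x')).card : ℝ) ≤ j := by exact_mod_cast hfib x' hx'
          exact mul_le_mul_of_nonneg_right h1 (mul_nonneg (ht0B x' hx') (hT0 x'))
      _ = (j : ℝ) * t * m := by rw [hm, Finset.mul_sum]; exact Finset.sum_congr rfl fun x' _ => by ring
  have hPE : μ.real E = ∑ s, W s * ind E s := prodBernoulli_real_eq_sum_weight_ind p E
  have hXcard : ∀ s, X s = ((B.filter (fun x => ((P x : Finset ι) : Set ι) ⊆ s)).card : ℝ) := by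
    intro s
    rw [hX]
    have : ∀ x, ind {ω : Set ι | ((P x : Finset ι) : Set ι) ⊆ ω} s = if ((P x : Finset ι) : Set ι) ⊆ s then 1 else 0 := by
      intro x
      by_cases h : ((P x : Finset ι) : Set ι) ⊆ s
      · rw [if_pos h, ind_of_mem (show s ∈ {ω : Set ι | ((P x : Finset ι) : Set ι) ⊆ ω} from h)]
      · rw [if_neg h, ind_of_not_mem (show s ∉ {ω : Set ι | ((P x : Finset ι) : Set ι) ⊆ ω} from h)]
    simp_rw [this]
    rw [Finset.sum_boole]
  have hmarkov : 4 * lam ^ 2 * μ.real E ≤ ∑ s, W s * (m - X s + lam) ^ 2 := by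
    rw [hPE, Finset.mul_sum]
    refine Finset.sum_le_sum fun s _ => ?_
    by_cases hs : s ∈ E
    · rw [ind_of_mem hs, mul_one]
      have hXle : X s ≤ j := by
        rw [hXcard s]
        exact_mod_cast (show s ∈ E from hs)
      have h2 : 2 * lam ≤ m - X s + lam := by rw [hlam]; linarith
      have hl : 0 ≤ lam := by rw [hlam]; linarith
      have h3 : (2 * lam) ^ 2 ≤ (m - X s + lam) ^ 2 := pow_le_pow_left₀ (by linarith) h2 2
      nlinarith [hW0 s, h3]
    · rw [ind_of_not_mem hs, mul_zero, mul_zero]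
      exact mul_nonneg (hW0 s) (sq_nonneg _)
  have hexp2 : ∑ s, W s * (m - X s + lam) ^ 2 = ∑ s, W s * (X s - m) ^ 2 + lam ^ 2 := by
    have : ∀ s, W s * (m - X s + lam) ^ 2 =
        W s * (X s - m) ^ 2 - 2 * lam * (W s * X s) + (2 * lam * m + lam ^ 2) * W s := by
      intro s; ring
    simp_rw [this]
    rw [Finset.sum_add_distrib, Finset.sum_sub_distrib, ← Finset.mul_sum, ← Finset.mul_sum, hmean, hW1]
    ring
  rw [hexp2] at hmarkov
  linarith

/-- **FAR for independent legs with relay subset `B` (spiders with arbitrary relay placement), every layer.**  Gates `ι` on legs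
(`leg`, `depth`), independent with parameters `p`; `B` the relays; `T x = ∏_{prefix x} p` the marginal of relay `x`;
`N_B(ω) = #{x ∈ B | prefix of x ⊆ ω}`.  If `2j < Σ_{x ∈ B} T x` (`= E N_B`) and `1 − T x ≤ t` for every `x ∈ B`, then `P(N_B ≤ j) ≤ t`:
`Quant.FarRelayRow` on spiders in gate coordinates, the relays being any subset of the path vertices. [this work] -/
theorem far_indepLegs_sub (leg : ι → J) (depth : ι → ℕ) (p : ι → unitInterval) (B : Finset ι) (j : ℕ) (t : ℝ)
    (hmean : (2 * j : ℝ) < ∑ x ∈ B, ∏ y ∈ univ.filter (fun y => leg y = leg x ∧ depth y ≤ depth x), (p y : ℝ))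
    (ht : ∀ x ∈ B, 1 - ∏ y ∈ univ.filter (fun y => leg y = leg x ∧ depth y ≤ depth x), (p y : ℝ) ≤ t) :
    (prodBernoulli p).real {ω : Set ι |
      (B.filter (fun x => ((univ.filter (fun y => leg y = leg x ∧ depth y ≤ depth x) : Finset ι) : Set ι) ⊆ ω)).card ≤ j} ≤ t := by
  set μ := prodBernoulli p with hμ
  set P : ι → Finset ι := fun x => univ.filter (fun y => leg y = leg x ∧ depth y ≤ depth x) with hP
  set T : ι → ℝ := fun x => ∏ y ∈ P x, (p y : ℝ) with hT
  set E : Set (Set ι) := {ω : Set ι | (B.filter (fun x => ((P x : Finset ι) : Set ι) ⊆ ω)).card ≤ j} with hE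
  set m : ℝ := ∑ x ∈ B, T x with hm
  have hp0 : ∀ i, (0 : ℝ) ≤ p i := fun i => (p i).2.1
  have hp1 : ∀ i, (p i : ℝ) ≤ 1 := fun i => (p i).2.2
  have hT1 : ∀ x, T x ≤ 1 := fun x => Finset.prod_le_one (fun y _ => hp0 y) fun y _ => hp1 y
  by_cases ht1 : 1 ≤ t
  · exact measureReal_le_one.trans ht1
  push Not at ht1
  have hcard : 2 * j + 1 ≤ B.card := by
    have h1 : ∑ x ∈ B, T x ≤ ∑ _x ∈ B, (1 : ℝ) := Finset.sum_le_sum fun x _ => hT1 x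
    rw [Finset.sum_const, nsmul_eq_mul, mul_one] at h1
    have h2 : (2 * j : ℝ) < (B.card : ℝ) := lt_of_lt_of_le hmean h1
    exact_mod_cast h2
  by_cases ht2 : t ≤ 1 / 2
  · -- regime (C): the rank form with the whole of `B`
    exact indepLegs_rank_smallBall_sub leg depth p B B (Finset.Subset.refl B) j t ht2 hcard ht
  push Not at ht2
  by_cases hbig : ∃ x ∈ B, j + 1 ≤ (B.filter (fun y => leg y = leg x)).card
  · -- regime (A): a leg with ≥ j+1 relays of `B`
    obtain ⟨x, hxB, hx⟩ := hbig
    set F : Finset ι := B.filter (fun y => leg y = leg x) with hF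
    have hxF : x ∈ F := Finset.mem_filter.2 ⟨hxB, rfl⟩
    obtain ⟨z, hz, hmax⟩ := Finset.exists_max_image F depth ⟨x, hxF⟩
    rw [Finset.mem_filter] at hz
    have hsub : E ⊆ {ω : Set ι | ((P z : Finset ι) : Set ι) ⊆ ω}ᶜ := by
      intro ω hω hωz
      have hωE : (B.filter (fun x' => ((P x' : Finset ι) : Set ι) ⊆ ω)).card ≤ j := hω
      have hincl : F ⊆ B.filter (fun x' => ((P x' : Finset ι) : Set ι) ⊆ ω) := by
        intro y hy
        rw [Finset.mem_filter] at hy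
        refine Finset.mem_filter.2 ⟨hy.1, fun y' hy' => ?_⟩
        have hy'P : y' ∈ P y := Finset.mem_coe.1 hy'
        simp only [hP, Finset.mem_filter, Finset.mem_univ, true_and] at hy'P
        have hy'z : y' ∈ P z := by
          simp only [hP, Finset.mem_filter, Finset.mem_univ, true_and]
          exact ⟨hy'P.1.trans (hy.2.trans hz.2.symm), hy'P.2.trans (hmax y (Finset.mem_filter.2 hy))⟩
        exact hωz (Finset.mem_coe.2 hy'z)
      have := Finset.card_le_card hincl
      omega
    calc μ.real E ≤ μ.real {ω : Set ι | ((P z : Finset ι) : Set ι) ⊆ ω}ᶜ := measureReal_mono hsub (measure_ne_top _ _)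
      _ = 1 - μ.real {ω : Set ι | ((P z : Finset ι) : Set ι) ⊆ ω} := probReal_compl_eq_one_sub MeasurableSet.of_discrete
      _ = 1 - T z := by rw [hμ, prodBernoulli_real_subset]
      _ ≤ t := ht z hz.1
  · -- regime (B): Cantelli
    push Not at hbig
    have hfib : ∀ x ∈ B, (B.filter (fun y => leg y = leg x)).card ≤ j := fun x hx => Nat.lt_succ_iff.1 (hbig x hx)
    have hj0 : (0 : ℝ) ≤ j := Nat.cast_nonneg _
    have hc := indepLegs_cantelli_sub leg depth p B j t hfib ht (by linarith)
    have hm0 : 0 < m := by linarith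
    have hlam : m / 2 < m - j := by linarith
    have hlam0 : 0 < m - j := by linarith
    have hjm : (j : ℝ) * m ≤ 2 * (m - j) ^ 2 := by nlinarith
    have ht0 : 0 ≤ t := by linarith
    have h1 : (j : ℝ) * t * m ≤ 2 * t * (m - j) ^ 2 := by nlinarith
    have h2 : 4 * (m - j) ^ 2 * μ.real E ≤ (2 * t + 1) * (m - j) ^ 2 := by linarith
    have h3 : 4 * μ.real E ≤ 2 * t + 1 := le_of_mul_le_mul_right (by linarith) (pow_pos hlam0 2)
    linarith


/-- **FAR for spiders with relay subset `B`, root-in-`A` cell.**  If the root is itself a relay (count `N_B + 1`, mean `1 + Σ_{x∈B} T x`),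
layer `j + 1`: `2(j+1) < 1 + Σ_{x∈B} T x` and `1 − T x ≤ t` on `B` imply `P(N_B + 1 ≤ j + 1) ≤ t`. [this work] -/
theorem far_indepLegs_sub_root (leg : ι → J) (depth : ι → ℕ) (p : ι → unitInterval) (B : Finset ι) (j : ℕ) (t : ℝ)
    (hmean : (2 * (j + 1) : ℝ) < 1 + ∑ x ∈ B, ∏ y ∈ univ.filter (fun y => leg y = leg x ∧ depth y ≤ depth x), (p y : ℝ))
    (ht : ∀ x ∈ B, 1 - ∏ y ∈ univ.filter (fun y => leg y = leg x ∧ depth y ≤ depth x), (p y : ℝ) ≤ t) :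
    (prodBernoulli p).real {ω : Set ι |
      (B.filter (fun x => ((univ.filter (fun y => leg y = leg x ∧ depth y ≤ depth x) : Finset ι) : Set ι) ⊆ ω)).card + 1 ≤ j + 1} ≤ t := by
  have hE : {ω : Set ι |
      (B.filter (fun x => ((univ.filter (fun y => leg y = leg x ∧ depth y ≤ depth x) : Finset ι) : Set ι) ⊆ ω)).card + 1 ≤ j + 1} =
      {ω : Set ι |
      (B.filter (fun x => ((univ.filter (fun y => leg y = leg x ∧ depth y ≤ depth x) : Finset ι) : Set ι) ⊆ ω)).card ≤ j} := by
    ext ω; simp only [Set.mem_setOf_eq]; omega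
  rw [hE]
  exact far_indepLegs_sub leg depth p B j t (by linarith) ht

end Quant

end Summit.CriticalPhenomena.PercolationContinuityZ3.Theorems

end
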